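import Literature.AlgebraicGeometry.HodgeTheory.WeilClassesDescending
import Literature.AlgebraicGeometry.HodgeTheory.WeilClassesDescendingProofs
import Literature.AlgebraicGeometry.HodgeTheory.WeilClassesSurfacesAlgebraic
import Literature.AlgebraicGeometry.HodgeTheory.WeilClassesProducts
import Literature.AlgebraicGeometry.HodgeTheory.GysinProjectionNonvanishing
import Literature.AlgebraicGeometry.HodgeTheory.GysinBaseChangeOfKunneth
import Literature.AlgebraicGeometry.HodgeTheory.GysinBaseChange
import Literature.AlgebraicGeometry.HodgeTheory.SupportedHodgeClassDescent
import Literature.AlgebraicGeometry.HodgeTheory.HodgeIndexSurface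
import Literature.AlgebraicGeometry.HodgeTheory.HodgeClassesCupPairing
import Literature.AlgebraicGeometry.HodgeTheory.LefschetzOneOne
import Literature.AlgebraicGeometry.HodgeTheory.ComplexConjugation
import Literature.AlgebraicGeometry.HodgeTheory.GysinKernelProofs
import Literature.AlgebraicTopology.SingularHomology.GysinMapSupportProofs
import HarnessLib

/-!
# Schoen's transfer in every even dimension, on the carriers: `Schoen1998_weilClasses_algebraic_of_prod_surface_all` PROVED

Family `hodge`, layer `Literature/AlgebraicGeometry/HodgeTheory`. Sibling PROOF file of
`WeilClassesDescending` (next to `WeilClassesDescendingProofs`, the partner-surface half), which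
states the named fact
`Schoen1998_weilClasses_algebraic_of_prod_surface_all` (C. Schoen, *Addendum to: Hodge classes on
self-products of a variety with an automorphism*, Compositio Math. 114 (1998) 329–336, §10
Proposition and its proof, pp. 332–333 — printed for `6 → 4`; E. Markman, arXiv:2509.23403 §11.5
Step 2 "It follows that the Weil classes of `(A₁,η₁,h₁)` are algebraic, by [schoen]"; K. Koike,
Canad. Math. Bull. 47 (2004), Rem. 2.1): for `n, d ≥ 1`, a complex abelian `2n`-fold `(A₁, φ₁)` and a
complex abelian surface `(A₂, φ₂)` OF WEIL TYPE WITH ITS DESCENT PARTNER (a rational `(1,1)`-class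
`u₊ + u₋` of its Weil plane, `u₊ ∈ E₊`, `u₋ ∈ E₋` both non-zero, and an algebraic class
`t ∈ N¹H²(A₂(ℂ); ℂ)` with `u₊ ∪ t ≠ 0`, `u₋ ∪ t ≠ 0` — Schoen's "`cl(D) ∈ W_{A'}`"), IF every rational
`(n+1,n+1)`-class of the Weil plane of `(A₁ × A₂, φ₁ × φ₂)` is algebraic THEN every rational
`(n,n)`-class of the Weil plane of `(A₁, φ₁)` is algebraic. No named fact is introduced here, and
**the fact IS discharged**: `Schoen1998_weilClasses_algebraic_of_prod_surface_all_holds` (end of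
file), the three-line specialisation of the unconditional lemma form
`Schoen1998_weilClasses_algebraic_of_prod_surface_all_of_partner` in which the partner divisor class
is given. (History: until the re-cut of 2026-08-16 — D-0026 review of the decomposition
`stub_descend ⇐ partner fact + transfer fact` — the fact's Weil-type witness omitted `t`; for an
ABSTRACT surface `A₂` the proof then needed the two named facts of the layer that supply `t` —
Lefschetz's theorem on `(1,1)`-classes (`lefschetzOneOne_rational`, file `LefschetzOneOne`: "`W_{A'}` is
generated by cohomology classes of divisors") and the Hodge index theorem for surfaces
(`hodgeIndex_surface`, file `HodgeIndexSurface`: the non-degeneracy behind "the cup product … is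
surjective"), or Lefschetz `(1,1)` alone (`WeilClassesDescendingOfLefschetzOneOne`). Those reductions,
`…_of_lefschetzOneOne_of_hodgeIndex` and `…_of_lefschetzOneOne_of_cupPairing` below, remain true and
are kept; Schoen prints `D` together with the construction of `A'` (p. 333, first lines of the
proof), so `t` now travels with the partner fact `exists_weilTypeSurface_prod_isHyperbolicWeilType_all`.)

## The printed proof (Schoen §10, p. 333) and its carriers

"It follows from 6 and the hypotheses of the proposition that the Weil cohomology, `W_{A×A'}`, is
generated by cohomology classes of algebraic cycles. We claim that `W_A` is generated by
cohomology classes of algebraic cycles of the form `pr_{A*}(z · (A × D))` where `cl(z) ∈ W_{A×A'}`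
and `cl(D) ∈ W_{A'}`. To check this, it is only necessary to show that the cup product in the
following diagram is surjective: `W_{A×A'} ⊗ (H⁰(A) ⊗ W_{A'}) →∪ W_A ⊗ H⁴(A') →pr_{A*} W_A`." Every
sentence is dimension-free, and on the carriers of the layer it reads, for a rational `(n,n)` Weil
class `c = c₊ + c₋` of `(A₁, φ₁)` and the Weil-type witness `u = u₊ + u₋` of `(A₂, φ₂)`:

1. (UPWARD HALF, the rational Weil projector — a THEOREM of the tree in all dimensions,
   `weilEigencomponents_cupProduct_fst_snd_mem_algebraicClasses`, file `WeilClassesProducts`)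
   `pr₁^* c± ∪ pr₂^* u±` lie in the Weil lines `E±(A₁ × A₂)` and are ALGEBRAIC on `A₁ × A₂`, the
   hypothesis being fed the RATIONAL `(n+1,n+1)` Weil classes `q(T)P`, `T q(T) P` of the product
   (`P = pr₁^* c ∪ pr₂^* u`, `T = (x·𝟙 + φ₁ × φ₂)^*`, `q ∈ ℚ[X]`). The Hodge type `(n+1,n+1)` of `P`
   is certified by the layer's THEOREMS `nonempty_hodgeModel_holds` (GAGA + Hodge decomposition),
   `hodgePQ_independent_of_hodgeModel_holds`, and de Rham's theorem in multiplicative form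
   `Literature.NumberTheory.Transcendental.exists_deRhamIsoFamily_holds`
   (`preservesHodgeType_of_nonempty_hodgeModel`, `cupPreservesHodgeType_of_nonempty_hodgeModel`).
2. (THE PARTNER DIVISOR) an ALGEBRAIC class `t ∈ N¹ H²(A₂(ℂ); ℂ)` with `u₊ ∪ t ≠ 0` and
   `u₋ ∪ t ≠ 0` — Schoen's `cl(D) ∈ W_{A'}` together with his surjectivity ("an explicit
   computation with differential forms … `ω_{5,σ₁} ∧ ω_{6,σ₁} ∧ ω_{5,σ₂} ∧ ω_{6,σ₂}` is a basis for
   `H⁴(A'; ℂ)`"). Since the re-cut of 2026-08-16 the fact's witness CARRIES `t` (Schoen constructs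
   `A'` with it); for an ABSTRACT Weil-type surface given without `t` this is where the two named
   facts would enter (`exists_algebraic_partner_of_hodgeIndex_of_algebraic`: `u` is algebraic by
   Lefschetz `(1,1)`, the intersection form on `NS(A₂)_ℚ ∋ u` is non-degenerate by the index
   theorem, and `u₋ ∪ t = conj (u₊ ∪ t)` by `conjClass_cupProduct` and `u₋ = conj u₊`,
   `eq_conjClass_of_isRationalClass_add` of `WeilClassesDescendingProofs`), and for the companion
   surfaces `E × E` it is PROVED (`exists_weilTypeSurface_descentPartner` below, from
   `exists_weilType_abelianSurfaces_algebraic` of `WeilClassesSurfacesAlgebraic`).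
3. `(pr₁^* c± ∪ pr₂^* u±) ∪ pr₂^* t` is algebraic on `A₁ × A₂` — `pr₂^* t` is (flat pull-back,
   `map_snd_mem_supportedClasses`) and divisor classes move by translations on an abelian variety
   (`AbelianVariety.cupProduct_mem_algebraicClasses_one`, Kleiman–Bertini; Schoen's `z · (A × D)`).
4. (THE TRANSFER) along the tree's REAL Gysin morphism `pr_{1*} = complexGysin μ` (Poincaré
   duality, `OrientationFamily.hasPoincareDuality`): `pr_{1*}` of that algebraic class is algebraic
   (`complexGysin_mem_algebraicClasses`, Borel–Moore base change
   `gysinMap_restrictCompl_eq_zero_of_field ℂ`), equals `c± ∪ pr_{1*} pr₂^*(u± ∪ t)` (projection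
   formula `complexGysin_cup`), and `pr_{1*} pr₂^*(u± ∪ t) = ε± · 1` with `ε± ≠ 0` because a non-zero
   top class of `A₂` has non-zero fibre integral (`complexGysin_fst_map_snd_ne_zero`, file
   `GysinProjectionNonvanishing`; Künneth spanning `kunnethSpan_complexBetti`). Hence `c±`, and `c`,
   are algebraic.

## What is proved

* `conjClass_cupProduct`, `cupProduct_weilComponents_ne_zero` — complex conjugation on `H*(Y; ℂ)`
  is multiplicative; as it swaps the two Weil eigen-components of a RATIONAL Weil class
  `u = u₊ + u₋` (`eq_conjClass_of_isRationalClass_add`, file `WeilClassesDescendingProofs`),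
  `u ∪ t ≠ 0` for a rational `t` forces `u₊ ∪ t ≠ 0` and `u₋ ∪ t ≠ 0`.
* `complexGysin_fst_cupProduct_cupProduct_map_snd`, `mem_algebraicClasses_of_complexGysin_fst_cupProduct`
  — step 4 along `complexGysin μ` (the `GysinFormalism`-relative forms are the tree's
  `gysin_fst_cupProduct_cupProduct_map_snd`, `mem_algebraicClasses_of_gysin_fst_cupProduct` of
  `WeilClassesFourfoldsProofs`; the `complexGysin` forms were so far only available on the summit
  side, `Summits/HodgeConjecture/…/HeckePrymWeilProductDescentTransfer`, which Literature cannot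
  import — same statements, to be deduplicated there).
* `exists_algebraic_partner_of_hodgeIndex_of_algebraic` — step 2 from `hodgeIndex_surface A₂.X`
  for an ALGEBRAIC rational Weil class `u = u₊ + u₋ ≠ 0`.
* `Schoen1998_weilClasses_algebraic_of_prod_surface_all_of_partner` — **Schoen's Proposition in
  every even dimension for ONE Weil pair and a GIVEN partner divisor class `t`** (steps 1, 3, 4):
  UNCONDITIONAL (no named fact; `φᵢ ≫ φᵢ = -d` is not even used).
* `Schoen1998_weilClasses_algebraic_of_prod_surface_all_of_rationalPartner` — the same with the
  partner given as a rational algebraic `a` with `(u₊ + u₋) ∪ a ≠ 0` (conjugation splits it).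
* `Schoen1998_weilClasses_algebraic_of_prod_surface_all_of_algebraic_of_hodgeIndex` — the same with
  `t` manufactured from "`u₊ + u₋` is algebraic" and `hodgeIndex_surface A₂.X` (per-surface form).
* `Schoen1998_weilClasses_algebraic_of_prod_surface_all_of_lefschetzOneOne_of_hodgeIndex` — the
  named fact from the two named facts `lefschetzOneOne_rational` and `hodgeIndex_surface` (the
  pre-re-cut route, which ignores the descent partner carried by the witness);
  `…_of_lefschetzOneOne_of_cupPairing` — the same with the index theorem replaced by the perfect
  pairing `hodgeClasses_cupPairing_nondegenerate 2` on surfaces (file `HodgeClassesCupPairing`).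
* `exists_weilTypeSurface_descentPartner` — for every `d ≥ 1` the companion surface `E_i × E_i` of
  `WeilClassesSurfacesAlgebraic` with its Weil class `b = u₊ + u₋` and `t = b` satisfies the surface
  conjuncts of the (re-cut) partner fact: the descent partner is PROVED to exist in every `ℚ(√-d)`.
* `Schoen1998_weilClasses_algebraic_of_prod_surface_all_holds` — **the DISCHARGE**: the fact's
  Weil-type witness carries Schoen's descent partner `t`, and `…_of_partner` concludes; nothing
  unproved is used (the partner divisor is supplied by the companion surface `E × E` in
  `WeilClassesSurfacesAlgebraic`, proved, and in general by whoever proves the partner fact).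

## References

* [Schoen1998HodgeWeilAddendum] C. Schoen, Addendum to: Hodge classes on self-products of a variety
  with an automorphism, Compositio Math. 114 (1998) 329–336, §10 (Proposition and proof, pp. 332–333).
* [Markman2025SurveySecant] E. Markman, Secant sheaves and Weil classes on abelian varieties,
  arXiv:2509.23403, §11.5 Step 2.
* [Koike2004WeilHodge] K. Koike, Algebraicity of some Weil Hodge classes, Canad. Math. Bull. 47
  (2004), Thm. 2.1 and Rem. 2.1.
* [vanGeemen1994HodgeAV] B. van Geemen, An introduction to the Hodge conjecture for abelian
  varieties, LNM 1594 (1994), Lemma 5.2 (6) and its proof (the two Weil lines are conjugate).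
* [VoisinHodgeI2002] C. Voisin, Hodge Theory and Complex Algebraic Geometry I, Cor. 6.12 (complex
  conjugation on `Hᵏ(X, ℂ)`), Thm. 11.30 (Lefschetz `(1,1)`).
* [Hartshorne1977] R. Hartshorne, Algebraic Geometry, V Thm. 1.9, Rem. 1.9.1, App. A Thm. 5.2.
* [BrosnanFangNiePearlstein2009] P. Brosnan, H. Fang, Z. Nie, G. Pearlstein, Singularities of
  admissible normal functions, Invent. Math. 177 (2009), §6 (6.1) (perfect pairing on Hodge classes).
* [FultonYoungTableaux1997] W. Fulton, Young Tableaux, Appendix B §B.1 (5)–(6) (Gysin maps,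
  projection formula).
* [HatcherAT2002] A. Hatcher, Algebraic Topology, §3.2 Prop. 3.10, §3.3 Thm. 3.30.
-/

noncomputable section

open scoped Manifold
open CategoryTheory MonoidalCategory CartesianMonoidalCategory

namespace Literature.AlgebraicGeometry.HodgeTheory

open Literature.AlgebraicTopology.SingularHomology

section SchoenTransfer

/-! ### Complex conjugation is multiplicative; eigencomponents of a rational class -/

/-- **`conj (a ∪ b) = conj a ∪ conj b`** on `H*(Y; ℂ)`: on Alexander–Whitney cochains,
`conj ((φ ⌣ ψ)(σ)) = conj (φ(σ|front)) · conj (ψ(σ|back))` (Voisin I, Cor. 6.12: conjugation acts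
on `Hᵏ(X, ℂ) = Hᵏ(X, ℝ) ⊗ ℂ`, compatibly with the real cup product).
[cite: VoisinHodgeI2002, Cor. 6.12] [cite: HatcherAT2002, §3.2 Prop. 3.10] -/
theorem conjClass_cupProduct {Y : Type} [TopologicalSpace Y] {p q m : ℕ} (h : p + q = m)
    (a : singularCohomology ℂ ℂ Y p) (b : singularCohomology ℂ ℂ Y q) :
    conjClass Y m (cupProduct h a b) = cupProduct h (conjClass Y p a) (conjClass Y q b) := by
  induction a using singularCohomology_induction_on with
  | h za =>
    induction b using singularCohomology_induction_on with
    | h zb =>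
      rw [cupProduct_π_π, conjClass_π, conjClass_π, conjClass_π, cupProduct_π_π]
      refine congrArg _ (singularCochainComplex.cocycles_ext ?_)
      rw [iCocycles_conjCocycle, singularCochainComplex.iCocycles_cocyclesCup,
        singularCochainComplex.iCocycles_cocyclesCup, iCocycles_conjCocycle, iCocycles_conjCocycle]
      exact singularCochainComplex.ext fun σ ↦ by
        simp only [conjCochain_apply, cochainCup_apply, map_mul]

/-- **Both Weil eigen-components of a rational Weil class of a surface pair non-trivially with a
rational partner.** For `d ≥ 1`, `u₊ ∈ E₊`, `u₋ ∈ E₋` (`weilClassesPlus/Minus A φ 1 d`) with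
`u₊ + u₋` RATIONAL, and a RATIONAL class `t ∈ H²(A(ℂ); ℂ)` with `(u₊ + u₋) ∪ t ≠ 0` in `H⁴`: both
`u₊ ∪ t ≠ 0` and `u₋ ∪ t ≠ 0`. Indeed `u₋ = conj u₊` (`eq_conjClass_of_isRationalClass_add`: the two
Weil lines are complex conjugate, van Geemen, proof of Lemma 5.2 (6)), conjugation is
multiplicative (`conjClass_cupProduct`) and fixes the rational `t`, so `u₋ ∪ t = conj (u₊ ∪ t)` and
the two summands of `(u₊ + u₋) ∪ t ≠ 0` vanish together (Schoen §10: both basis lines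
`ω_{5,σᵢ} ∧ ω_{6,σᵢ}` of `W_{A'} ⊗ ℂ` pair non-trivially with the divisor class).
[cite: Schoen1998HodgeWeilAddendum, §10 (proof of the Proposition)]
[cite: vanGeemen1994HodgeAV, proof of Lemma 5.2 (6)] [cite: VoisinHodgeI2002, Cor. 6.12] -/
theorem cupProduct_weilComponents_ne_zero {A : Motives.AbelianVariety ℂ} {φ : A ⟶ A} {d : ℕ}
    (hd : 0 < d) {up um t : complexBetti A.X (2 * 1)} (hup : up ∈ weilClassesPlus A φ 1 d)
    (hum : um ∈ weilClassesMinus A φ 1 d) (hr : IsRationalClass (up + um)) (ht : IsRationalClass t)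
    (hbt : cupProduct two_add_two (up + um) t ≠ 0) :
    cupProduct two_add_two up t ≠ 0 ∧ cupProduct two_add_two um t ≠ 0 := by
  have hconj : conjClass (Motives.ComplexPoints A.X) 2 up = um :=
    (eq_conjClass_of_isRationalClass_add Nat.one_pos hd hup hum hr).symm
  have hm : cupProduct two_add_two um t =
      conjClass (Motives.ComplexPoints A.X) 4 (cupProduct two_add_two up t) := by
    rw [conjClass_cupProduct, hconj, ht.conjClass_eq]
  have hp : cupProduct two_add_two up t ≠ 0 := by
    intro h
    apply hbt
    rw [map_add, LinearMap.add_apply, hm, h, conjClass_zero, add_zero]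
  refine ⟨hp, ?_⟩
  rw [hm]
  intro h
  apply hp
  rw [← conjClass_conjClass (cupProduct two_add_two up t), h, conjClass_zero]

/-! ### Schoen's transfer along the real Gysin morphisms `complexGysin μ` -/

section Transfer

variable (μ : OrientationFamily) {A₁ A₂ : Motives.AbelianVariety ℂ} {m₁ m₂ : ℕ}

/-- **`pr_{1*}((pr₁^* c ∪ pr₂^* u) ∪ pr₂^* η) = c ∪ pr_{1*} pr₂^*(u ∪ η)`** on `A₁ × A₂` along the
tree's real Gysin morphism `complexGysin μ` of the first projection (`dim Aᵢ = mᵢ`,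
`deg u + deg η = 2m₂`): associativity and naturality of `∪` and the projection formula
`complexGysin_cup` (Fulton, App. B (6); Poincaré duality for `μ` is the tree's theorem
`OrientationFamily.hasPoincareDuality`). This is the cohomological shadow of Schoen's cycle
`pr_{A*}(z · (A × D))` for `cl(z) = pr_A^* c ∪ pr_{A'}^* u`, `η = cl(D)`; the `GysinFormalism`-relative
form is the tree's `gysin_fst_cupProduct_cupProduct_map_snd`.
[cite: Schoen1998HodgeWeilAddendum, §10 (proof of the Proposition)]
[cite: FultonYoungTableaux1997, Appendix B §B.1 (6)] -/
theorem complexGysin_fst_cupProduct_cupProduct_map_snd (hA₁ : Motives.IsSmoothProjective m₁ A₁.X)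
    (hA₂ : Motives.IsSmoothProjective m₂ A₂.X) {k j j' s t : ℕ} (hkj : k + j = s)
    (hjj' : j + j' = 2 * m₂) (hst : s + j' = t) (c : complexBetti A₁.X k) (u : complexBetti A₂.X j)
    (η : complexBetti A₂.X j') :
    complexGysin μ (Motives.IsSmoothProjective.tensor_holds hA₁ hA₂) hA₁
        (Motives.AbelianVariety.fst A₁ A₂).hom.hom.hom
        (show t + 2 * m₁ = k + 2 * (m₁ + m₂) by omega)
        (cupProduct hst
          (cupProduct hkj (complexBetti.map (Motives.AbelianVariety.fst A₁ A₂).hom.hom.hom k c)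
            (complexBetti.map (Motives.AbelianVariety.snd A₁ A₂).hom.hom.hom j u))
          (complexBetti.map (Motives.AbelianVariety.snd A₁ A₂).hom.hom.hom j' η)) =
      cupProduct (Nat.add_zero k) c
        (complexGysin μ (Motives.IsSmoothProjective.tensor_holds hA₁ hA₂) hA₁
          (Motives.AbelianVariety.fst A₁ A₂).hom.hom.hom
          (show 2 * m₂ + 2 * m₁ = 0 + 2 * (m₁ + m₂) by omega)
          (complexBetti.map (Motives.AbelianVariety.snd A₁ A₂).hom.hom.hom (2 * m₂)
            (cupProduct hjj' u η))) := by
  rw [cupProduct_assoc hkj hjj' hst (by omega), ← cupProduct_map]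
  exact complexGysin_cup (OrientationFamily.hasPoincareDuality μ) _ hA₁ _
    (show k + 2 * m₂ = t by omega) _ _ (Nat.add_zero k) c _

/-- **Schoen's transfer (§10 of the Addendum) along `complexGysin μ`.** Let `A₁`, `A₂` be complex
abelian varieties, smooth projective of dimensions `m₁`, `m₂`, `c ∈ H^{2l}(A₁(ℂ); ℂ)`,
`u ∈ Hʲ(A₂(ℂ); ℂ)`, `η ∈ H^{j'}(A₂(ℂ); ℂ)` with `j + j' = 2m₂`. IF `(pr₁^* c ∪ pr₂^* u) ∪ pr₂^* η` is
algebraic on `A₁ × A₂` (codimension `l + m₂`) AND the fibre integral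
`pr_{1*} pr₂^*(u ∪ η) ∈ H⁰(A₁(ℂ); ℂ)` is non-zero — Schoen's "the cup product in the following
diagram is surjective" — THEN `c` is algebraic: push-forwards of algebraic classes along
`complexGysin μ` are algebraic (`complexGysin_mem_algebraicClasses`; the Borel–Moore base change is
the tree's theorem `gysinMap_restrictCompl_eq_zero_of_field ℂ`), the push-forward equals
`c ∪ pr_{1*} pr₂^*(u ∪ η)` (`complexGysin_fst_cupProduct_cupProduct_map_snd`), and
`pr_{1*} pr₂^*(u ∪ η) = ε · 1` (`exists_eq_smul_one`) with `ε ≠ 0`. The `GysinFormalism`-relative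
form is the tree's `mem_algebraicClasses_of_gysin_fst_cupProduct`.
[cite: Schoen1998HodgeWeilAddendum, §10 Proposition (proof)] [cite: Markman2025SurveySecant, §11.5 Step 2]
[cite: FultonYoungTableaux1997, Appendix B §B.1 (5)–(6)] -/
theorem mem_algebraicClasses_of_complexGysin_fst_cupProduct (hA₁ : Motives.IsSmoothProjective m₁ A₁.X)
    (hA₂ : Motives.IsSmoothProjective m₂ A₂.X) {l j j' s : ℕ} (hkj : 2 * l + j = s)
    (hjj' : j + j' = 2 * m₂) {c : complexBetti A₁.X (2 * l)} {u : complexBetti A₂.X j}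
    {η : complexBetti A₂.X j'}
    (hne : complexGysin μ (Motives.IsSmoothProjective.tensor_holds hA₁ hA₂) hA₁
        (Motives.AbelianVariety.fst A₁ A₂).hom.hom.hom
        (show 2 * m₂ + 2 * m₁ = 0 + 2 * (m₁ + m₂) by omega)
        (complexBetti.map (Motives.AbelianVariety.snd A₁ A₂).hom.hom.hom (2 * m₂)
          (cupProduct hjj' u η)) ≠ 0)
    (halg : cupProduct (show s + j' = 2 * (l + m₂) by omega)
        (cupProduct hkj (complexBetti.map (Motives.AbelianVariety.fst A₁ A₂).hom.hom.hom (2 * l) c)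
          (complexBetti.map (Motives.AbelianVariety.snd A₁ A₂).hom.hom.hom j u))
        (complexBetti.map (Motives.AbelianVariety.snd A₁ A₂).hom.hom.hom j' η) ∈
          algebraicClasses (A₁.prod A₂).X (l + m₂)) :
    c ∈ algebraicClasses A₁.X l := by
  have hμ : μ.HasPoincareDuality := OrientationFamily.hasPoincareDuality μ
  have h1 := complexGysin_mem_algebraicClasses (gysinMap_restrictCompl_eq_zero_of_field ℂ) μ hμ
    (Motives.IsSmoothProjective.tensor_holds hA₁ hA₂) hA₁ (Motives.AbelianVariety.fst A₁ A₂).hom.hom.hom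
    (q := l + m₂) (p := l) (by omega) (by omega) halg
  rw [complexGysin_fst_cupProduct_cupProduct_map_snd μ hA₁ hA₂ hkj hjj'] at h1
  set w := complexGysin μ (Motives.IsSmoothProjective.tensor_holds hA₁ hA₂) hA₁
        (Motives.AbelianVariety.fst A₁ A₂).hom.hom.hom
        (show 2 * m₂ + 2 * m₁ = 0 + 2 * (m₁ + m₂) by omega)
        (complexBetti.map (Motives.AbelianVariety.snd A₁ A₂).hom.hom.hom (2 * m₂)
          (cupProduct hjj' u η)) with hw
  obtain ⟨ε, hε⟩ := exists_eq_smul_one μ hA₁ w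
  rw [hε, map_smul, cupProduct_one] at h1
  have hε0 : ε ≠ 0 := fun h ↦ hne (by rw [hε, h, zero_smul])
  have h3 := Submodule.smul_mem (algebraicClasses A₁.X l) ε⁻¹ h1
  rwa [smul_smul, inv_mul_cancel₀ hε0, one_smul] at h3

end Transfer

/-! ### The partner divisor class on the surface (Hodge index, for an algebraic Weil class) -/

/-- **The algebraic partner of an ALGEBRAIC rational Weil class on a surface.** Let `(A, φ)` be a
complex abelian variety, smooth projective of dimension `2`, `d ≥ 1`, `u₊ ∈ E₊`, `u₋ ∈ E₋`
(`weilClassesPlus/Minus A φ 1 d`) with `u = u₊ + u₋ ≠ 0` RATIONAL and ALGEBRAIC (`u ∈ N¹ H²`; for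
the rational `(1,1)`-class `u` this is Lefschetz `(1,1)`, `lefschetzOneOne_rational` — Schoen:
"`W_{A'}` is generated by cohomology classes of divisors"). GRANTED the Hodge index theorem for `A`
(`hodgeIndex_surface A.X`, a NAMED FACT of the tree) there is an ALGEBRAIC class
`t ∈ N¹ H²(A(ℂ); ℂ)` with `u₊ ∪ t ≠ 0` and `u₋ ∪ t ≠ 0`: with the ample class `h` of the fact,
`t = h` if `u ∪ h ≠ 0` and `t = u` otherwise (`u ∪ h = 0`, `u ≠ 0` ⟹ `u ∪ u ≠ 0` — Hartshorne V
Thm. 1.9 / App. A Thm. 5.2, sign-free), and `cupProduct_weilComponents_ne_zero` (`t` is rational).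
This is the form in which the non-degeneracy of the pairing on `NS(A')_ℚ ⊇ W_{A'}` (Schoen's
surjectivity, §10) enters on the carriers. [cite: Hartshorne1977, V Thm. 1.9, V Rem. 1.9.1 and App. A Thm. 5.2]
[cite: Schoen1998HodgeWeilAddendum, §10 (proof of the Proposition)] -/
theorem exists_algebraic_partner_of_hodgeIndex_of_algebraic {A : Motives.AbelianVariety ℂ}
    {φ : A ⟶ A} {d : ℕ} (hd : 0 < d) (hHI : hodgeIndex_surface A.X)
    (hA : Motives.IsSmoothProjective 2 A.X) {up um : complexBetti A.X (2 * 1)}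
    (hup : up ∈ weilClassesPlus A φ 1 d) (hum : um ∈ weilClassesMinus A φ 1 d)
    (hr : IsRationalClass (up + um)) (hN : up + um ∈ algebraicClasses A.X 1) (h0 : up + um ≠ 0) :
    ∃ t : complexBetti A.X (2 * 1), t ∈ algebraicClasses A.X 1 ∧ cupProduct two_add_two up t ≠ 0 ∧
      cupProduct two_add_two um t ≠ 0 := by
  obtain ⟨h, hh, -, hhN, -, hindex⟩ := hHI hA
  -- a rational algebraic `t` with `u ∪ t ≠ 0`: `h`, or `u` itself
  obtain ⟨t, htr, htN, hbt⟩ : ∃ t : complexBetti A.X (2 * 1), IsRationalClass t ∧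
      t ∈ algebraicClasses A.X 1 ∧ cupProduct two_add_two (up + um) t ≠ 0 := by
    by_cases hbh : cupProduct two_add_two (up + um) h = 0
    · exact ⟨up + um, hr, hN, hindex _ hr hN hbh h0⟩
    · exact ⟨h, hh, hhN, hbh⟩
  obtain ⟨hpt, hmt⟩ := cupProduct_weilComponents_ne_zero hd hup hum hr htr hbt
  exact ⟨t, htN, hpt, hmt⟩

/-! ### Schoen's Proposition in every even dimension, for one Weil pair -/

section Schoen

variable {A₁ A₂ : Motives.AbelianVariety ℂ}

/-- **Schoen's transfer in every even dimension, for ONE Weil pair and a GIVEN partner divisor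
class (unconditional).** Let `n, d ≥ 1`, `(A₁, φ₁)` a complex abelian variety smooth projective of
dimension `2n`, `(A₂, φ₂)` one of dimension `2` (endomorphisms `φᵢ`; `φᵢ ≫ φᵢ = -d` is NOT needed),
`u₊ ∈ E₊(A₂, φ₂)`, `u₋ ∈ E₋(A₂, φ₂)` with `u₊ + u₋` RATIONAL of Hodge type `(1,1)`, and `t` an
ALGEBRAIC class of `H²(A₂(ℂ); ℂ)` with `u₊ ∪ t ≠ 0`, `u₋ ∪ t ≠ 0` (Schoen: `cl(D) ∈ W_{A'}` and the
surjectivity of `W_{A×A'} ⊗ W_{A'} → W_A ⊗ H⁴(A') → W_A`). IF every rational `(n+1,n+1)`-class of the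
Weil plane of `(A₁ × A₂, φ₁ × φ₂)` is algebraic, THEN every rational `(n,n)`-class `c` of the Weil
plane `weilClassesOf A₁ φ₁ n d` is algebraic. Proof = module docstring, steps 1, 3, 4: `c = c₊ + c₋`;
`pr₁^* c± ∪ pr₂^* u±` are algebraic on `A₁ × A₂` (rational Weil projector,
`weilEigencomponents_cupProduct_fst_snd_mem_algebraicClasses`, the Hodge type of `pr₁^* c ∪ pr₂^* u`
by `nonempty_hodgeModel_holds`, `hodgePQ_independent_of_hodgeModel_holds`,
`exists_deRhamIsoFamily_holds`); so are their products with `pr₂^* t` (translations move divisors,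
`AbelianVariety.cupProduct_mem_algebraicClasses_one`); and
`pr_{1*}((pr₁^* c± ∪ pr₂^* u±) ∪ pr₂^* t) = ε± · c±`, `ε± · 1 = pr_{1*} pr₂^*(u± ∪ t) ≠ 0`
(`mem_algebraicClasses_of_complexGysin_fst_cupProduct`, `complexGysin_fst_map_snd_ne_zero`).
[cite: Schoen1998HodgeWeilAddendum, §10 (Proposition and proof, pp. 332–333)]
[cite: Markman2025SurveySecant, §11.5 Step 2] [cite: Koike2004WeilHodge, Thm. 2.1 and Rem. 2.1] -/
theorem Schoen1998_weilClasses_algebraic_of_prod_surface_all_of_partner {n d : ℕ} (hn : 0 < n)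
    (hd : 0 < d) (φ₁ : A₁ ⟶ A₁) (φ₂ : A₂ ⟶ A₂) (hA₁ : Motives.IsSmoothProjective (2 * n) A₁.X)
    (hA₂ : Motives.IsSmoothProjective (2 * 1) A₂.X) {up um t : complexBetti A₂.X (2 * 1)}
    (hup : up ∈ weilClassesPlus A₂ φ₂ 1 d) (hum : um ∈ weilClassesMinus A₂ φ₂ 1 d)
    (hr₂ : IsRationalClass (up + um)) (hw₂ : IsOfHodgeType (2 * 1) A₂.X (2 * 1) 1 1 (up + um))
    (ht : t ∈ algebraicClasses A₂.X 1)
    (hpt : cupProduct (show 2 * 1 + 2 * 1 = 2 * (2 * 1) from rfl) up t ≠ 0)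
    (hmt : cupProduct (show 2 * 1 + 2 * 1 = 2 * (2 * 1) from rfl) um t ≠ 0)
    (hB : ∀ c : complexBetti (A₁.prod A₂).X (2 * (n + 1)), IsRationalClass c →
      IsOfHodgeType (2 * (n + 1)) (A₁.prod A₂).X (2 * (n + 1)) (n + 1) (n + 1) c →
        c ∈ weilClassesOf (A₁.prod A₂)
          (Motives.AbelianVariety.prodLift (Motives.AbelianVariety.fst A₁ A₂ ≫ φ₁)
            (Motives.AbelianVariety.snd A₁ A₂ ≫ φ₂)) (n + 1) d →
        c ∈ algebraicClasses (A₁.prod A₂).X (n + 1))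
    {c : complexBetti A₁.X (2 * n)} (hc : IsRationalClass c)
    (hcH : IsOfHodgeType (2 * n) A₁.X (2 * n) n n c) (hcW : c ∈ weilClassesOf A₁ φ₁ n d) :
    c ∈ algebraicClasses A₁.X n := by
  -- the product is smooth projective of dimension `2(n+1)`; an orientation family
  have hAB : Motives.IsSmoothProjective (2 * (n + 1)) (A₁.prod A₂).X :=
    isSmoothProjective_prod_two_mul hA₁ hA₂
  let μ : OrientationFamily := fun _ _ h ↦ Classical.choice (Motives.ComplexPoints.isOrientableOver ℂ h)
  -- `c = c₊ + c₋`
  obtain ⟨cp, hcp, cm, hcm, rfl⟩ := Submodule.mem_sup.1 hcW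
  -- Hodge type `(n+1, n+1)` of `pr₁^* c ∪ pr₂^* u`: Hodge models, independence of `H^{p,q}` and the
  -- multiplicative de Rham theorem are theorems of the tree
  have hI := hodgePQ_independent_of_hodgeModel_holds
  have hfst : PreservesHodgeType (2 * (n + 1)) (2 * n) (Motives.AbelianVariety.fst A₁ A₂).hom.hom.hom :=
    preservesHodgeType_of_nonempty_hodgeModel hI nonempty_hodgeModel_holds hAB hA₁ _
  have hsnd : PreservesHodgeType (2 * (n + 1)) (2 * 1) (Motives.AbelianVariety.snd A₁ A₂).hom.hom.hom :=
    preservesHodgeType_of_nonempty_hodgeModel hI nonempty_hodgeModel_holds hAB hA₂ _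
  have hcupH : CupPreservesHodgeType (2 * (n + 1)) (A₁.prod A₂).X :=
    cupPreservesHodgeType_of_nonempty_hodgeModel hI nonempty_hodgeModel_holds
      (fun E _ _ _ ↦ Literature.NumberTheory.Transcendental.exists_deRhamIsoFamily_holds E) hAB
  have h : 2 * n + 2 * 1 = 2 * (n + 1) := by ring
  have hH := isOfHodgeType_cupProduct_map_map (p₁ := Motives.AbelianVariety.fst A₁ A₂)
    (p₂ := Motives.AbelianVariety.snd A₁ A₂) h hfst hsnd hcupH hcH hw₂
  -- upward half: `pr₁^* c± ∪ pr₂^* u±` are algebraic on `A₁ × A₂`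
  obtain ⟨hP, hM⟩ := weilEigencomponents_cupProduct_fst_snd_mem_algebraicClasses hn Nat.one_pos hd h
    hA₁ hA₂ hB hcp hcm hup hum hc hr₂ hH
  -- `pr₂^* t` is algebraic on `A₁ × A₂`, hence so are `(pr₁^* c± ∪ pr₂^* u±) ∪ pr₂^* t`
  have ht' : complexBetti.map (Motives.AbelianVariety.snd A₁ A₂).hom.hom.hom (2 * 1) t ∈
      algebraicClasses (A₁.prod A₂).X 1 :=
    map_snd_mem_supportedClasses hA₁ hA₂ ht
  have halgp := AbelianVariety.cupProduct_mem_algebraicClasses_one (A₁.prod A₂) hP ht'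
  have halgm := AbelianVariety.cupProduct_mem_algebraicClasses_one (A₁.prod A₂) hM ht'
  -- the fibre integrals `pr_{1*} pr₂^*(u± ∪ t) ≠ 0`
  have hjj' : 2 * 1 + 2 * 1 = 2 * (2 * 1) := rfl
  -- (`complexGysin_fst_map_snd_ne_zero`, file `GysinProjectionNonvanishing`, typed over
  -- `A₁.X ⊗ A₂.X = (A₁.prod A₂).X`; the projections agree definitionally)
  have hnep := complexGysin_fst_map_snd_ne_zero μ hA₁ hA₂ hpt
  have hnem := complexGysin_fst_map_snd_ne_zero μ hA₁ hA₂ hmt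
  -- Schoen's transfer, component by component
  refine Submodule.add_mem _ ?_ ?_
  · exact mem_algebraicClasses_of_complexGysin_fst_cupProduct μ hA₁ hA₂ (l := n) (j := 2 * 1)
      (j' := 2 * 1) (s := 2 * (n + 1)) h hjj' hnep halgp
  · exact mem_algebraicClasses_of_complexGysin_fst_cupProduct μ hA₁ hA₂ (l := n) (j := 2 * 1)
      (j' := 2 * 1) (s := 2 * (n + 1)) h hjj' hnem halgm

/-- **Schoen's transfer in every even dimension, for one Weil pair, given a RATIONAL ALGEBRAIC
partner of the Weil class of the surface.** As
`Schoen1998_weilClasses_algebraic_of_prod_surface_all_of_partner`, but the partner is given in the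
weaker shape "a rational class `a ∈ N¹ H²(A₂(ℂ); ℂ)` with `(u₊ + u₋) ∪ a ≠ 0`" (what the index
theorem, or the perfect pairing on `Hdg¹(A₂)` plus Lefschetz `(1,1)`, delivers): both
`u₊ ∪ a ≠ 0` and `u₋ ∪ a ≠ 0` follow by conjugation (`cupProduct_weilComponents_ne_zero`).
[cite: Schoen1998HodgeWeilAddendum, §10 (Proposition and proof, pp. 332–333)]
[cite: vanGeemen1994HodgeAV, proof of Lemma 5.2 (6)] -/
theorem Schoen1998_weilClasses_algebraic_of_prod_surface_all_of_rationalPartner {n d : ℕ}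
    (hn : 0 < n) (hd : 0 < d) (φ₁ : A₁ ⟶ A₁) (φ₂ : A₂ ⟶ A₂)
    (hA₁ : Motives.IsSmoothProjective (2 * n) A₁.X) (hA₂ : Motives.IsSmoothProjective (2 * 1) A₂.X)
    {up um a : complexBetti A₂.X (2 * 1)} (hup : up ∈ weilClassesPlus A₂ φ₂ 1 d)
    (hum : um ∈ weilClassesMinus A₂ φ₂ 1 d) (hr₂ : IsRationalClass (up + um))
    (hw₂ : IsOfHodgeType (2 * 1) A₂.X (2 * 1) 1 1 (up + um)) (har : IsRationalClass a)
    (haN : a ∈ algebraicClasses A₂.X 1) (hua : cupProduct two_add_two (up + um) a ≠ 0)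
    (hB : ∀ c : complexBetti (A₁.prod A₂).X (2 * (n + 1)), IsRationalClass c →
      IsOfHodgeType (2 * (n + 1)) (A₁.prod A₂).X (2 * (n + 1)) (n + 1) (n + 1) c →
        c ∈ weilClassesOf (A₁.prod A₂)
          (Motives.AbelianVariety.prodLift (Motives.AbelianVariety.fst A₁ A₂ ≫ φ₁)
            (Motives.AbelianVariety.snd A₁ A₂ ≫ φ₂)) (n + 1) d →
        c ∈ algebraicClasses (A₁.prod A₂).X (n + 1))
    {c : complexBetti A₁.X (2 * n)} (hc : IsRationalClass c)
    (hcH : IsOfHodgeType (2 * n) A₁.X (2 * n) n n c) (hcW : c ∈ weilClassesOf A₁ φ₁ n d) :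
    c ∈ algebraicClasses A₁.X n := by
  obtain ⟨hpt, hmt⟩ := cupProduct_weilComponents_ne_zero hd hup hum hr₂ har hua
  have hpt' : cupProduct (show 2 * 1 + 2 * 1 = 2 * (2 * 1) from rfl) up a ≠ 0 := hpt
  have hmt' : cupProduct (show 2 * 1 + 2 * 1 = 2 * (2 * 1) from rfl) um a ≠ 0 := hmt
  exact Schoen1998_weilClasses_algebraic_of_prod_surface_all_of_partner hn hd φ₁ φ₂ hA₁ hA₂ hup hum
    hr₂ hw₂ haN hpt' hmt' hB hc hcH hcW

/-- **Schoen's transfer in every even dimension, for one Weil pair, from "the Weil class of the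
partner surface is algebraic" and the Hodge index theorem for that surface.** As
`Schoen1998_weilClasses_algebraic_of_prod_surface_all_of_partner`, with the partner divisor class
manufactured (`exists_algebraic_partner_of_hodgeIndex_of_algebraic`) from: `u₊ + u₋ ≠ 0` is
ALGEBRAIC on `A₂` (Schoen: "`W_{A'}` is generated by cohomology classes of divisors" — Lefschetz
`(1,1)` for the rational `(1,1)`-class `u₊ + u₋`) and `hodgeIndex_surface A₂.X` (the tree's named
fact, here a hypothesis about this one surface).
[cite: Schoen1998HodgeWeilAddendum, §10 (Proposition and proof, pp. 332–333)]
[cite: Hartshorne1977, App. A Thm. 5.2] [cite: VoisinHodgeI2002, Thm. 11.30] -/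
theorem Schoen1998_weilClasses_algebraic_of_prod_surface_all_of_algebraic_of_hodgeIndex {n d : ℕ}
    (hn : 0 < n) (hd : 0 < d) (φ₁ : A₁ ⟶ A₁) (φ₂ : A₂ ⟶ A₂)
    (hA₁ : Motives.IsSmoothProjective (2 * n) A₁.X) (hA₂ : Motives.IsSmoothProjective (2 * 1) A₂.X)
    {up um : complexBetti A₂.X (2 * 1)} (hup : up ∈ weilClassesPlus A₂ φ₂ 1 d)
    (hum : um ∈ weilClassesMinus A₂ φ₂ 1 d) (hr₂ : IsRationalClass (up + um))
    (hw₂ : IsOfHodgeType (2 * 1) A₂.X (2 * 1) 1 1 (up + um))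
    (hN : up + um ∈ algebraicClasses A₂.X 1) (h0 : up + um ≠ 0) (hHI : hodgeIndex_surface A₂.X)
    (hB : ∀ c : complexBetti (A₁.prod A₂).X (2 * (n + 1)), IsRationalClass c →
      IsOfHodgeType (2 * (n + 1)) (A₁.prod A₂).X (2 * (n + 1)) (n + 1) (n + 1) c →
        c ∈ weilClassesOf (A₁.prod A₂)
          (Motives.AbelianVariety.prodLift (Motives.AbelianVariety.fst A₁ A₂ ≫ φ₁)
            (Motives.AbelianVariety.snd A₁ A₂ ≫ φ₂)) (n + 1) d →
        c ∈ algebraicClasses (A₁.prod A₂).X (n + 1))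
    {c : complexBetti A₁.X (2 * n)} (hc : IsRationalClass c)
    (hcH : IsOfHodgeType (2 * n) A₁.X (2 * n) n n c) (hcW : c ∈ weilClassesOf A₁ φ₁ n d) :
    c ∈ algebraicClasses A₁.X n := by
  have hA₂' : Motives.IsSmoothProjective 2 A₂.X := hA₂
  obtain ⟨t, htN, hpt, hmt⟩ :=
    exists_algebraic_partner_of_hodgeIndex_of_algebraic hd hHI hA₂' hup hum hr₂ hN h0
  have hpt' : cupProduct (show 2 * 1 + 2 * 1 = 2 * (2 * 1) from rfl) up t ≠ 0 := hpt
  have hmt' : cupProduct (show 2 * 1 + 2 * 1 = 2 * (2 * 1) from rfl) um t ≠ 0 := hmt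
  exact Schoen1998_weilClasses_algebraic_of_prod_surface_all_of_partner hn hd φ₁ φ₂ hA₁ hA₂ hup hum
    hr₂ hw₂ htN hpt' hmt' hB hc hcH hcW

end Schoen

/-! ### The named fact from Lefschetz `(1,1)` and the Hodge index theorem -/

/-- **`Schoen1998_weilClasses_algebraic_of_prod_surface_all` holds GRANTED the two named facts
`lefschetzOneOne_rational` (Voisin I Thm. 11.30) and `hodgeIndex_surface` (Hartshorne App. A
Thm. 5.2, for every smooth projective surface).** Schoen's §10 Proposition in every even dimension
on the tree's real carriers: for the Weil-type witness `u = u₊ + u₋` of the partner surface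
(`u±` both non-zero, so `u ≠ 0` as `E₊ ⊓ E₋ = 0`, `disjoint_weilClassesPlus_weilClassesMinus`),
Lefschetz `(1,1)` makes the rational `(1,1)`-class `u` algebraic, the index theorem supplies the
partner divisor, and `Schoen1998_weilClasses_algebraic_of_prod_surface_all_of_algebraic_of_hodgeIndex`
concludes. Nothing else is assumed (Hodge models, the independence of `H^{p,q}` from the model, de
Rham's theorem, Poincaré duality, Künneth spanning, Borel–Moore base change and the moving of
divisors on abelian varieties are theorems of the tree). Discharging the named fact amounts to
discharging these two facts for abelian surfaces of Weil type.
[cite: Schoen1998HodgeWeilAddendum, §10 (Proposition and proof, pp. 332–333)]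
[cite: Markman2025SurveySecant, §11.5 Step 2] [cite: Koike2004WeilHodge, Rem. 2.1]
[cite: VoisinHodgeI2002, Thm. 11.30] [cite: Hartshorne1977, App. A Thm. 5.2] -/
theorem Schoen1998_weilClasses_algebraic_of_prod_surface_all_of_lefschetzOneOne_of_hodgeIndex
    (hL : lefschetzOneOne_rational) (hHI : ∀ X : Motives.SchemeOver ℂ, hodgeIndex_surface X) :
    Schoen1998_weilClasses_algebraic_of_prod_surface_all := by
  intro n hn d hd A₁ φ₁ A₂ φ₂ _ hA₁ _ _ hA₂ _ hwt hB c hc hcH hcW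
  obtain ⟨up, um, hup, hum, hr₂, hw₂, hup0, -⟩ := hwt
  -- `u = u₊ + u₋ ≠ 0` since `E₊ ⊓ E₋ = 0`
  have h0 : up + um ≠ 0 := by
    intro h
    have hup' : up ∈ weilClassesMinus A₂ φ₂ 1 d := by
      rw [eq_neg_of_add_eq_zero_left h]
      exact Submodule.neg_mem _ hum
    exact hup0 (Submodule.disjoint_def.mp
      (disjoint_weilClassesPlus_weilClassesMinus A₂ φ₂ Nat.one_pos hd) up hup hup')
  -- Lefschetz `(1,1)`: the rational `(1,1)`-class `u` of the surface is algebraic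
  have hN : up + um ∈ algebraicClasses A₂.X 1 := hL hA₂ (up + um) hr₂ hw₂
  exact Schoen1998_weilClasses_algebraic_of_prod_surface_all_of_algebraic_of_hodgeIndex hn hd φ₁ φ₂
    hA₁ hA₂ hup hum hr₂ hw₂ hN h0 (hHI A₂.X) hB hc hcH hcW

/-- **`Schoen1998_weilClasses_algebraic_of_prod_surface_all` holds GRANTED the two named facts
`lefschetzOneOne_rational` (Voisin I Thm. 11.30) and `hodgeClasses_cupPairing_nondegenerate 2`
(the perfect pairing `Hdg¹ ⊗ Hdg¹ → ℚ` on a surface: Poincaré duality + Hodge–Riemann, BFNP 2009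
(6.1); file `HodgeClassesCupPairing`)** — the alternative to the index theorem: the non-zero
rational `(1,1)` Weil class `u` of the partner surface has a rational `(1,1)` partner `a` with
`u ∪ a ≠ 0`, algebraic by Lefschetz `(1,1)`, and
`Schoen1998_weilClasses_algebraic_of_prod_surface_all_of_rationalPartner` concludes. Nothing else
is assumed. [cite: Schoen1998HodgeWeilAddendum, §10 (Proposition and proof, pp. 332–333)]
[cite: BrosnanFangNiePearlstein2009, §6 (6.1)] [cite: VoisinHodgeI2002, Thm. 11.30 and Thm. 6.32] -/
theorem Schoen1998_weilClasses_algebraic_of_prod_surface_all_of_lefschetzOneOne_of_cupPairing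
    (hL : lefschetzOneOne_rational)
    (hP : ∀ X : Motives.SchemeOver ℂ, hodgeClasses_cupPairing_nondegenerate 2 X) :
    Schoen1998_weilClasses_algebraic_of_prod_surface_all := by
  intro n hn d hd A₁ φ₁ A₂ φ₂ _ hA₁ _ _ hA₂ _ hwt hB c hc hcH hcW
  obtain ⟨up, um, hup, hum, hr₂, hw₂, hup0, -⟩ := hwt
  -- `u = u₊ + u₋ ≠ 0` since `E₊ ⊓ E₋ = 0`
  have h0 : up + um ≠ 0 := by
    intro h
    have hup' : up ∈ weilClassesMinus A₂ φ₂ 1 d := by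
      rw [eq_neg_of_add_eq_zero_left h]
      exact Submodule.neg_mem _ hum
    exact hup0 (Submodule.disjoint_def.mp
      (disjoint_weilClassesPlus_weilClassesMinus A₂ φ₂ Nat.one_pos hd) up hup hup')
  have hA₂' : Motives.IsSmoothProjective 2 A₂.X := hA₂
  -- the perfect pairing on `Hdg¹(A₂)`: a rational `(1,1)` partner `a` of `u`
  obtain ⟨a, har, ha11, hua⟩ :=
    hP A₂.X hA₂' (k := 1) (l := 1) (2 * (2 * 1)) rfl rfl (up + um) hr₂ hw₂ h0
  -- Lefschetz `(1,1)`: `a` is algebraic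
  have haN : a ∈ algebraicClasses A₂.X 1 := hL hA₂' a har ha11
  have hua' : cupProduct two_add_two (up + um) a ≠ 0 := hua
  exact Schoen1998_weilClasses_algebraic_of_prod_surface_all_of_rationalPartner hn hd φ₁ φ₂ hA₁ hA₂
    hup hum hr₂ hw₂ har haN hua' hB hc hcH hcW

/-! ### The discharge -/

/-- **The partner surface WITH its descent partner exists for every `d ≥ 1` (surface conjuncts of
`exists_weilTypeSurface_prod_isHyperbolicWeilType_all`, proved).** The companion surface
`B = E_i × E_i`, `ψ = ((0,-d),(1,0))` of `exists_weilType_abelianSurfaces_algebraic` (file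
`WeilClassesSurfacesAlgebraic`): its Weil class `b = u₊ + u₋` is rational of type `(1,1)`, ALGEBRAIC,
with `b ∪ b ≠ 0`, hence `u± ≠ 0` (`ne_zero_of_isRationalClass_add`) and `u₊ ∪ b ≠ 0`, `u₋ ∪ b ≠ 0`
(`cupProduct_weilComponents_ne_zero`): `t = b` is a descent partner — Schoen's "`W_{A'}` is generated
by cohomology classes of divisors" with the basis `ω_{5,σ₁} ∧ ω_{6,σ₁} ∧ ω_{5,σ₂} ∧ ω_{6,σ₂}` of
`H⁴(A'; ℂ)` (p. 333), on the tree's carriers, for the companion instead of the CM surface. What the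
partner fact asserts beyond this is the aiming (complementary discriminant, hyperbolic product).
[cite: Schoen1998HodgeWeilAddendum, §10 (proof of the Proposition, p. 333)]
[cite: vanGeemen1994HodgeAV, 5.3 and proof of Lemma 5.2 (6)] -/
theorem exists_weilTypeSurface_descentPartner (d : ℕ) (hd : 0 < d) :
    ∃ (A₂ : Motives.AbelianVariety ℂ) (φ₂ : A₂ ⟶ A₂), A₂.dim = 2 * 1 ∧
      Motives.IsSmoothProjective (2 * 1) A₂.X ∧ φ₂ ≫ φ₂ = -(d • 𝟙 A₂) ∧
      ∃ up um : complexBetti A₂.X (2 * 1), up ∈ weilClassesPlus A₂ φ₂ 1 d ∧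
        um ∈ weilClassesMinus A₂ φ₂ 1 d ∧ IsRationalClass (up + um) ∧
        IsOfHodgeType (2 * 1) A₂.X (2 * 1) 1 1 (up + um) ∧ up ≠ 0 ∧ um ≠ 0 ∧
        ∃ t : complexBetti A₂.X (2 * 1), t ∈ algebraicClasses A₂.X 1 ∧
          cupProduct (show 2 * 1 + 2 * 1 = 2 * (2 * 1) from rfl) up t ≠ 0 ∧
          cupProduct (show 2 * 1 + 2 * 1 = 2 * (2 * 1) from rfl) um t ≠ 0 := by
  obtain ⟨B, ψ, b, hB, hψ, hrat, h11, hW, halg, hbb⟩ := exists_weilType_abelianSurfaces_algebraic d hd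
  obtain ⟨up, hup, um, hum, rfl⟩ := Submodule.mem_sup.mp hW
  have hsp : Motives.IsSmoothProjective (2 * 1) B.X := by
    have h := Motives.AbelianVariety.isSmoothProjective_holds (A := B)
    rw [Motives.AbelianVariety.isSmoothProjective, hB] at h
    exact h
  have hb0 : up + um ≠ 0 := fun h => hbb (by rw [h, LinearMap.map_zero₂])
  obtain ⟨hup0, hum0⟩ := ne_zero_of_isRationalClass_add Nat.one_pos hd hup hum hrat hb0
  have hbt : cupProduct two_add_two (up + um) (up + um) ≠ 0 := hbb
  obtain ⟨hpt, hmt⟩ := cupProduct_weilComponents_ne_zero hd hup hum hrat hrat hbt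
  exact ⟨B, ψ, hB, hsp, hψ, up, um, hup, hum, hrat, h11, hup0, hum0, up + um, halg, hpt, hmt⟩

end SchoenTransfer

/-- **`Schoen1998_weilClasses_algebraic_of_prod_surface_all` HOLDS** (C. Schoen, Compositio Math. 114
(1998), §10 Proposition and its proof, pp. 332–333, in every even dimension; Markman arXiv:2509.23403
§11.5 Step 2 "by [schoen]"; Koike 2004 Rem. 2.1). The fact's Weil-type witness of the partner
surface `(A₂, φ₂)` carries Schoen's descent partner — an algebraic class `t ∈ N¹H²(A₂(ℂ); ℂ)` with
`u₊ ∪ t ≠ 0`, `u₋ ∪ t ≠ 0` ("`cl(D) ∈ W_{A'}`", "`W_{A'}` is generated by cohomology classes of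
divisors", and the basis `ω_{5,σ₁} ∧ ω_{6,σ₁} ∧ ω_{5,σ₂} ∧ ω_{6,σ₂}` of `H⁴(A'; ℂ)`, p. 333) — and
`Schoen1998_weilClasses_algebraic_of_prod_surface_all_of_partner` (rational Weil projector on
`A₁ × A₂`, translation of divisors, Gysin push-forward along `pr₁`, non-zero fibre integral)
concludes. Relies on nothing unproved. (Declared at namespace level, outside every `section`, with
`theorem X_holds : X` on one line — the canonical textual shape of a discharge.) [cite: Schoen1998HodgeWeilAddendum, §10 (Proposition and proof, pp. 332–333)]
[cite: Markman2025SurveySecant, §11.5 Step 2] [cite: Koike2004WeilHodge, Thm. 2.1 and Rem. 2.1] -/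
theorem Schoen1998_weilClasses_algebraic_of_prod_surface_all_holds : Schoen1998_weilClasses_algebraic_of_prod_surface_all := by
  intro n hn d hd A₁ φ₁ A₂ φ₂ _ hA₁ _ _ hA₂ _ hwt hB c hc hcH hcW
  obtain ⟨up, um, hup, hum, hr₂, hw₂, -, -, t, ht, hpt, hmt⟩ := hwt
  exact Schoen1998_weilClasses_algebraic_of_prod_surface_all_of_partner hn hd φ₁ φ₂ hA₁ hA₂ hup hum
    hr₂ hw₂ ht hpt hmt hB hc hcH hcW

end Literature.AlgebraicGeometry.HodgeTheory

end
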